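/-
Copyright (c) 2026 the pub-hodgecm-mathlib formalisation cell (harness21).  Prover seat hodgecm-mathlib-K2E4-p07 (g2),
Track B «K2-LIT» ∕ h413, unit «FinGermConstants» of the line `K2_E4_SingularTransferKappaSign`, socket #7R
`K2E4SingularTransferKappaSign.FinGermConstants.sig_K2E3GermConstantRegularHR` (ED. 4), STEP (ii) of its non-split residue: NEAR `(ε_H, ε)` EVERY MATCHED ELEMENT IS
ON THE DOCK SIDE — the `ε′`-side classes of `γ_H` near `ε_H` do not come near `ε`.  2026-09-03.
-/
import Literature.NumberTheory.Rogawski1990.FinExplicitTransferFactorBadFrameConstancy      -- ★ p842237: the `ε′`-side constancy whose proof is replayed in §2 (+ ★ `finKappaAt_eq_ite_of_eigenvector`, ★ `finTau_eventually_eq`, …)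
import Literature.NumberTheory.Rogawski1990.FinExplicitTransferFactorLocallyConstant        -- ★ `continuousOn_finExplicitDelta`
import Literature.NumberTheory.Rogawski1990.FinExplicitTransferFactorGHRegular               -- ★ `finExplicitDelta_ne_zero_of_isUnit`
import Literature.NumberTheory.Rogawski1990.LocalStableClassesNonsplitScalarFrameKappa      -- ★ `finExplicitDelta_eq_neg_of_not_isConj_of_fst_eq_smul_one`
import Literature.NumberTheory.Rogawski1990.LocalNormFibreBlockDichotomyDock                -- ★ `coe_dock_mul_dockFrame` (+ ★ `not_frame_and_frame_of_local`)
import Literature.NumberTheory.Rogawski1990.LocalNormFibreBadFrameSecondClass               -- ★ `exists_secondClass_of_frame`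
import Literature.NumberTheory.Rogawski1990.LocalTransferCentralSingularJunctionCM          -- ★ `isUnit_eval_finCharpolyTwo_of_central`
import Literature.NumberTheory.Automorphic.UnitaryGroupFrameEmbedding                       -- ★ `finSum_mulVec_append`
import Literature.NumberTheory.Automorphic.LocalRegularOrbitClosed                          -- ★ `map_conjLocal_transpose_localForm`, ★ `isUnit_det_localForm`
import HarnessLib

/-!
# K2_E4 road (h413 = stmt-HodgeConjecture-24833), socket #7R `sig_K2E3GermConstantRegularHR`, non-split residue STEP (ii):
# near `(ε_H, ε)` every element matched with `γ_H` lies on the DOCK side — the `ε′`-side (bad-frame) classes stay away from `ε`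

Cell `pub/hodgecm-mathlib` (D-0151), Track B; socket **`sig_K2E3GermConstantRegularHR`** (FinGermConstants ED. 3∕4 :309, R-twin of #7; OWNER K2E3, base K2E4-p07).
Setting of the (R-inv) central singular junction at a non-split `v` [Rogawski1990 §8.2 Prop. 8.2.1 (a)(d) ⟸ Prop. 8.1.3]: `ε_H = (a·1₂, u)` (`u ≠ a`), the central dock
`θ : H_v ≃ₜ* Z_{G′_v}(ε)` with frame `y·W` (Gram blocks `G₁ ⊕ᶠ G₂`), and a BAD frame `P′` (Gram blocks `G₁′ ⊕ᶠ G₂′`, `det G₁′ ∉ det G₁ · N(L_w^×)`).  The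
norm class of a `G`-regular `γ_H` near `ε_H` in `G′_v` splits into the DOCK side (conjugates of `θ h`, `h ∼_st γ_H`) and the `Q′`-SIDE (conjugates of `P′·(B ⊕ᶠ u(γ_H))·P′⁻¹`).
THIS FILE proves that the `Q′`-side does not come near `ε`: there are `N ∈ 𝓝 ε_H` and `U ∈ 𝓝 ε` such that no `γ′ ∈ U` matched with a `G`-regular `γ_H ∈ N` is on the `Q′`-side
— so that, in the ε-only junction of #7R (STEP (iii)), a test function supported in `U` is invisible to the `Q′`-side classes.

THE MATHEMATICS (the Kottwitz sign separates the sides, and `Δ‴_v` is continuous).  Let `ε′ := P′·(a·1₂ ⊕ᶠ u)·P′⁻¹` be the second class (★ `exists_secondClass_of_frame`).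
(§1) `ε` and `ε′` both match `ε_H` (they are `GL₃`-conjugate to `ι_v(ε_H)`: ★ `coe_dock_mul_dockFrame`), and they are NOT `G′_v`-conjugate, since a conjugacy would realise `ε`
in both frames `y·W` and `P′` (★ `not_frame_and_frame_of_local`, `χ_{a·1}(u) = (u − a)²` a unit); hence `Δ‴_v(ε_H, ε′) = −Δ‴_v(ε_H, ε)` (★
`finExplicitDelta_eq_neg_of_not_isConj_of_fst_eq_smul_one`: at the scalar partner `κ_v(ε_H, ·)` separates the two classes).  (§2) `Δ‴_v(γ_H, γ′) = Δ‴_v(ε_H, ε′)` for `γ_H`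
near `ε_H` and `γ′` on the `Q′`-side (★ p842237's proof with its constant named: `τ_v`, `D` are eventually constant at `ε_H`, and `κ_v` of a `P′`-framed element is read on
the FIXED eigenvector `P′e₃`, the same for `γ′` and for `ε′` — ★ `finKappaAt_eq_ite_of_eigenvector`).  (§3) `(γ_H, γ′) ↦ Δ‴_v(γ_H, γ′)` is continuous on the matching locus
(★ `continuousOn_finExplicitDelta`) and `Δ₀ := Δ‴_v(ε_H, ε) ≠ 0` (★ `finExplicitDelta_ne_zero_of_isUnit`), so `Δ‴_v ≠ −Δ₀` on the matched pairs of some `N × U ∋ (ε_H, ε)`;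
a `Q′`-side `γ′ ∈ U` matched with `γ_H ∈ N` would have `Δ‴_v(γ_H, γ′) = −Δ₀`.

* §1 `finExplicitDelta_secondClass_eq_neg` — `Δ‴_v(ε_H, ε′) = −Δ‴_v(ε_H, ε)`.
* §2 `exists_nhds_finExplicitDelta_eq_secondClass_of_badFrame` — `Δ‴_v(γ_H, γ′) = Δ‴_v(ε_H, ε′)` on the `Q′`-side near `ε_H` (★ p842237 with the constant named).
* §3 **`exists_nhds_not_badFrame_of_isLocalNormPair`** — `∃ N ∈ 𝓝 ε_H, ∃ U ∈ 𝓝 ε`, no matched `(γ_H, γ′) ∈ N × U` (`γ_H` `G`-regular) is on the `Q′`-side.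

HONEST LABEL: HC_CM is proved only modulo the 7 printed citations (2 remaining named inputs: hLiu418 = stmt-HodgeConjecture-24832, h413 =
stmt-HodgeConjecture-24833) until rung 0 closes; this file is a `--supports stmt-HodgeConjecture-24833` helper (step (ii) of 4 of #7R's non-split residue) and retires
nothing by itself.
-/

set_option autoImplicit false
set_option linter.dupNamespace false

noncomputable section

open Set Filter Topology Matrix Polynomial NumberField IsDedekindDomain
open scoped MatrixGroups

namespace Summit.HodgeConjecture.HodgeConjecture.Cruxes.H413.K2E3GermConstantRegularHRDockSideOnly

open Literature.NumberTheory.Rogawski1990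
open Literature.NumberTheory.Automorphic Literature.NumberTheory.Automorphic.UnitaryGroup Literature.NumberTheory.GaloisRepresentations

section DockSide

variable (L : Type) [Field L] [NumberField L] [IsCMField L] (H' : Matrix (Fin 3) (Fin 3) L) (v : HeightOneSpectrum (𝓞 ↥(maximalRealSubfield L)))

omit [NumberField L] [IsCMField L] in
/-- **`(B ⊕ᶠ D)·e₃ = D₀₀·e₃`**: the last basis vector is an eigenvector of a `2 ⊕ 1` block matrix (local copy of ★ p842237's private lemma).
[cite: Rogawski1990, §4.8 Case (a) p. 53] -/
private theorem finSum_two_one_mulVec_single_two' {R : Type} [CommRing R] (B : Matrix (Fin 2) (Fin 2) R) (D : Matrix (Fin 1) (Fin 1) R) :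
    finSum 2 1 B D *ᵥ Pi.single (2 : Fin (2 + 1)) (1 : R) = (D 0 0) • Pi.single (2 : Fin (2 + 1)) (1 : R) := by
  have h1 : (Pi.single (2 : Fin (2 + 1)) (1 : R)) = Fin.append (0 : Fin 2 → R) (fun _ : Fin 1 => (1 : R)) := by
    ext i; fin_cases i <;> rfl
  have h2 : ((D 0 0) • Pi.single (2 : Fin (2 + 1)) (1 : R)) = Fin.append (0 : Fin 2 → R) (fun _ : Fin 1 => D 0 0) := by
    ext i; fin_cases i <;> simp [Fin.append, Fin.addCases]
  rw [h2, h1, finSum_mulVec_append, Matrix.mulVec_zero]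
  congr 1
  ext i
  have hi : i = 0 := Subsingleton.elim _ _
  subst hi
  simp [Matrix.mulVec, dotProduct]

omit [NumberField L] [IsCMField L] in
/-- An invertible matrix kills no non-zero vector. [folklore] -/
private theorem mulVec_ne_zero_of_ne_zero₃ {n : Type} [Fintype n] [DecidableEq n] {R : Type} [CommRing R] (g : GL n R) {p : n → R} (hp : p ≠ 0) :
    g.val *ᵥ p ≠ 0 := by
  intro h0
  apply hp
  have h1 : (g⁻¹).val *ᵥ (g.val *ᵥ p) = p := by
    rw [mulVec_mulVec, ← Units.val_mul, inv_mul_cancel, Units.val_one, one_mulVec]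
  rw [← h1, h0, mulVec_zero]

omit [NumberField L] [IsCMField L] in
/-- A `1 × 1` matrix is the scalar matrix of its entry. [folklore] -/
private theorem fin_one_eq_smul_one₃ {S : Type*} [CommRing S] (C : Matrix (Fin 1) (Fin 1) S) : C = C 0 0 • (1 : Matrix (Fin 1) (Fin 1) S) := by
  ext i j
  have hi : i = 0 := Subsingleton.elim _ _
  have hj : j = 0 := Subsingleton.elim _ _
  subst hi; subst hj
  rw [Matrix.smul_apply, Matrix.one_apply_eq, smul_eq_mul, mul_one]

omit [NumberField L] [IsCMField L] in
/-- **Two frames with the same block pattern give conjugate elements**: `g P = P D` and `g′ Q = Q D` in `GL_n` imply `(Q P⁻¹) g (Q P⁻¹)⁻¹ = g′`. [folklore] -/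
private theorem conj_eq_of_frames {n : Type} [Fintype n] [DecidableEq n] {R : Type} [CommRing R] {g g' P Q : GL n R} {D : Matrix n n R}
    (h1 : g.val * P.val = P.val * D) (h2 : g'.val * Q.val = Q.val * D) : (Q * P⁻¹) * g * (Q * P⁻¹)⁻¹ = g' := by
  have hD : D = (P⁻¹ * g * P).val := by
    rw [Units.val_mul, Units.val_mul, Matrix.mul_assoc, h1, ← Matrix.mul_assoc, Units.inv_mul, Matrix.one_mul]
  have h3 : g' * Q = Q * (P⁻¹ * g * P) := Units.ext (by rw [Units.val_mul, Units.val_mul Q, ← hD]; exact h2)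
  calc (Q * P⁻¹) * g * (Q * P⁻¹)⁻¹ = Q * (P⁻¹ * g * P) * Q⁻¹ := by group
    _ = g' * Q * Q⁻¹ := by rw [← h3]
    _ = g' := mul_inv_cancel_right g' Q

/-! ## §1  `Δ‴_v(ε_H, ε′) = −Δ‴_v(ε_H, ε)` for the second class `ε′` in the bad frame -/

/-- **The second class is matched with `ε_H` and carries the opposite sign**: with the dock `θ` (`θ ε_H = ε`, frame `y·W`, Gram blocks `G₁ ⊕ᶠ G₂`) and a bad frame `P′`
(Gram blocks `G₁′ ⊕ᶠ G₂′`, `det G₁′ ∉ det G₁ · N`), every `ε′ ∈ G′_v` with `ε′ P′ = P′ (a·1₂ ⊕ᶠ u)` matches `ε_H` and `Δ‴_v(ε_H, ε′) = −Δ‴_v(ε_H, ε)`: `ε`, `ε′` are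
`GL₃`-conjugate (both realise the pattern `a·1₂ ⊕ᶠ u`), and a `G′_v`-conjugacy `x ε x⁻¹ = ε′` would realise `ε` in both frames, against ★ `not_frame_and_frame_of_local`;
so ★ `finExplicitDelta_eq_neg_of_not_isConj_of_fst_eq_smul_one` applies at the scalar partner `ε_H`.
[cite: Rogawski1990, §3.8 Prop. 3.8.1 (d) p. 30; §4.3 (4.3.2) p. 43; §8.2 Prop. 8.2.1 (a)(d) pp. 118–122] [cite: LanglandsShelstad1987, §1] -/
theorem finExplicitDelta_secondClass_eq_neg (hH' : (H'.map (cmConjRingHom L))ᵀ = H') (hdet' : H'.det ≠ 0)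
    (w : PlacesOver L v) (hw : IsCMField.complexConj L • w.1 = w.1) (μ : HeckeCharacter L)
    (εH : ((cmDatum L 2 (Matrix.of fun i j : Fin 2 => if i.val + j.val + 1 = 2 then (1 : L) else 0)).Local v ×
      (cmDatum L 1 (Matrix.of fun i j : Fin 1 => if i.val + j.val + 1 = 1 then (1 : L) else 0)).Local v)) (a : LocalRing L v)
    (ha : (εH.1.val.val : Matrix (Fin 2) (Fin 2) (LocalRing L v)) = a • (1 : Matrix (Fin 2) (Fin 2) (LocalRing L v)))
    (hu : (εH.2.val.val : Matrix (Fin 1) (Fin 1) (LocalRing L v)) 0 0 ≠ a)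
    (ε : (cmDatum L 3 H').Local v) (y : GL (Fin 3) (LocalRing L v))
    (θ : ((cmDatum L 2 (Matrix.of fun i j : Fin 2 => if i.val + j.val + 1 = 2 then (1 : L) else 0)).Local v ×
      (cmDatum L 1 (Matrix.of fun i j : Fin 1 => if i.val + j.val + 1 = 1 then (1 : L) else 0)).Local v) ≃ₜ* ↥(Subgroup.centralizer ({ε} : Set ((cmDatum L 3 H').Local v)))) (hθε : (θ εH).1 = ε)
    (hθ : ∀ z : ((cmDatum L 2 (Matrix.of fun i j : Fin 2 => if i.val + j.val + 1 = 2 then (1 : L) else 0)).Local v ×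
      (cmDatum L 1 (Matrix.of fun i j : Fin 1 => if i.val + j.val + 1 = 1 then (1 : L) else 0)).Local v), (((θ z).1).val : GL (Fin 3) (LocalRing L v)) = y * ((endoEmbLocal L v z).val : GL (Fin 3) (LocalRing L v)) * y⁻¹)
    {W : GL (Fin 3) (LocalRing L v)} (hW : W.val = !![(1 : LocalRing L v), 0, 0; 0, 0, 1; 0, 1, 0])
    {G₁ G₁' : Matrix (Fin 2) (Fin 2) (LocalRing L v)} {G₂ G₂' : Matrix (Fin 1) (Fin 1) (LocalRing L v)} {P' : GL (Fin (2 + 1)) (LocalRing L v)}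
    (hPW : twistGram (conjLocal L (IsCMField.complexConj L) v) ((adelicForm L 3 H').map (adeleToLocal L v)) (y * W).val = finSum 2 1 G₁ G₂)
    (hP' : twistGram (conjLocal L (IsCMField.complexConj L) v) ((adelicForm L 3 H').map (adeleToLocal L v)) P'.val = finSum 2 1 G₁' G₂')
    (hnn : ¬ ∃ z : LocalRing L v, IsUnit z ∧ G₁'.det = G₁.det * (conjLocal L (IsCMField.complexConj L) v z * z))
    {ε' : (cmDatum L 3 H').Local v}
    (hε' : (ε'.val.val : Matrix (Fin 3) (Fin 3) (LocalRing L v)) * P'.val =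
      P'.val * finSum 2 1 (a • (1 : Matrix (Fin 2) (Fin 2) (LocalRing L v))) (εH.2.val.val : Matrix (Fin 1) (Fin 1) (LocalRing L v))) :
    IsLocalNormPair L H' v εH ε' ∧ finExplicitDelta L v H' εH μ ε' = -finExplicitDelta L v H' εH μ ε := by
  haveI hv : Subsingleton (PlacesOver L v) := PlacesOver.subsingleton_of_smul_eq (IsCMField.complexConj L) (IsCMField.complexConj_ne_one L) w hw
  have hu₀ : IsUnit ((finCharpolyTwo L v εH).eval (finGammaTwo L v εH)) := isUnit_eval_finCharpolyTwo_of_central L v w hw εH a ha hu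
  -- matching of `ε` along the dock
  have hyε : (ε.val : GL (Fin 3) (LocalRing L v)) = y * ((endoEmbLocal L v εH).val : GL (Fin 3) (LocalRing L v)) * y⁻¹ := by
    rw [← hθε]; exact hθ εH
  have hmε : IsLocalNormPair L H' v εH ε := isLocalNormPair_of_val_eq_conj hyε
  -- the two frame equations with the SAME block pattern `a·1₂ ⊕ᶠ u`
  have hdock : (ε.val.val : Matrix (Fin 3) (Fin 3) (LocalRing L v)) * (y * W).val =
      (y * W).val * finSum 2 1 (a • (1 : Matrix (Fin 2) (Fin 2) (LocalRing L v))) (εH.2.val.val : Matrix (Fin 1) (Fin 1) (LocalRing L v)) := by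
    have h := coe_dock_mul_dockFrame L H' v θ hθ hW εH
    rw [hθε, ha] at h
    exact h
  -- `ε′ = g ε g⁻¹` in `GL₃`, hence `ε′` matches `ε_H`
  have hconj : (P' * (y * W)⁻¹) * (ε.val : GL (Fin 3) (LocalRing L v)) * (P' * (y * W)⁻¹)⁻¹ = (ε'.val : GL (Fin 3) (LocalRing L v)) :=
    conj_eq_of_frames (g := (ε.val : GL (Fin 3) (LocalRing L v))) (g' := (ε'.val : GL (Fin 3) (LocalRing L v))) hdock hε'
  have hmε' : IsLocalNormPair L H' v εH ε' := isLocalNormPair_of_conj_eq L v H' εH ε ε' hmε hconj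
  refine ⟨hmε', ?_⟩
  -- `ε` and `ε′` are not `G′_v`-conjugate: two frames for `ε`
  have hbu : (εH.2.val.val : Matrix (Fin 1) (Fin 1) (LocalRing L v)) = finGammaTwo L v εH • (1 : Matrix (Fin 1) (Fin 1) (LocalRing L v)) :=
    fin_one_eq_smul_one₃ _
  have hχ : IsUnit ((a • (1 : Matrix (Fin 2) (Fin 2) (LocalRing L v))).charpoly.eval (finGammaTwo L v εH)) := by
    have h : finCharpolyTwo L v εH = (a • (1 : Matrix (Fin 2) (Fin 2) (LocalRing L v))).charpoly := by
      rw [finCharpolyTwo, ha]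
    rw [← h]; exact hu₀
  have hne : ¬ IsConj (⟨ε.val, ε.2⟩ : Literature.AlgebraicGeometry.ShimuraVarieties.unitaryGroup (conjLocal L (IsCMField.complexConj L) v)
      ((adelicForm L 3 H').map (adeleToLocal L v))) ⟨ε'.val, ε'.2⟩ := by
    intro hc
    obtain ⟨c, hcε⟩ := isConj_iff.1 hc
    -- `c` as an element of `G′_v`
    set x' : (cmDatum L 3 H').Local v := ⟨c.val, c.2⟩ with hx'def
    have h0 : c.val * ε.val * c.val⁻¹ = ε'.val := congrArg Subtype.val hcε
    have hx : x' * ε * x'⁻¹ = ε' := Subtype.ext h0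
    have h1 : (((1 : (cmDatum L 3 H').Local v) * ε * (1 : (cmDatum L 3 H').Local v)⁻¹).val.val : Matrix (Fin 3) (Fin 3) (LocalRing L v)) * (y * W).val =
        (y * W).val * finSum 2 1 (a • (1 : Matrix (Fin 2) (Fin 2) (LocalRing L v))) (finGammaTwo L v εH • (1 : Matrix (Fin 1) (Fin 1) (LocalRing L v))) := by
      rw [one_mul, inv_one, mul_one, ← hbu]; exact hdock
    have h2 : ((x' * ε * x'⁻¹).val.val : Matrix (Fin 3) (Fin 3) (LocalRing L v)) * P'.val =
        P'.val * finSum 2 1 (a • (1 : Matrix (Fin 2) (Fin 2) (LocalRing L v))) (finGammaTwo L v εH • (1 : Matrix (Fin 1) (Fin 1) (LocalRing L v))) := by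
      rw [hx, ← hbu]; exact hε'
    exact not_frame_and_frame_of_local L H' v hPW hP' hnn (γ' := ε) (x := 1) (x' := x') h1 h2 hχ hχ
  exact finExplicitDelta_eq_neg_of_not_isConj_of_fst_eq_smul_one L v H' εH ε ε' μ w hw hmε hmε' hu₀
    (map_conjLocal_transpose_localForm L 3 H' v hH') (isUnit_det_localForm L 3 H' v hdet') ha hne

/-! ## §2  `Δ‴_v = Δ‴_v(ε_H, ε′)` on the `Q′`-side near `ε_H` (★ p842237 with its constant named) -/

open scoped Classical in
/-- **`Δ‴_v(γ_H, γ′) = Δ‴_v(ε_H, ε′)` for `γ_H` near `ε_H` (`G`-regular) and `γ′` matched with `γ_H` and conjugate into the bad frame `P′` with second block `u(γ_H)`**, where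
`ε′ P′ = P′ (a·1₂ ⊕ᶠ u)` is the second class.  ★ p842237's proof, its constant IDENTIFIED: `τ_v`, `D` are eventually constant at `ε_H` (★ `finTau_eventually_eq`, ★
`finWeylRatio_eventually_eq`), and `κ_v` of a `P′`-framed element matched with a `γ_H` having `χ_g(u)` a unit is the unit-norm test of `⟨P′e₃, P′e₃⟩_{H′_v}` (★
`finKappaAt_eq_ite_of_eigenvector` on the common eigenvector `P′e₃`) — for `x γ′ x⁻¹` as well as for `ε′`.
[cite: Rogawski1990, §4.9 p. 55; §4.3 (4.3.2) p. 43; §8.1 Prop. 8.1.3 p. 116; §8.2 Prop. 8.2.1 (a) p. 112] [cite: LanglandsShelstad1987, §1] -/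
theorem exists_nhds_finExplicitDelta_eq_secondClass_of_badFrame (w : PlacesOver L v) (hw : IsCMField.complexConj L • w.1 = w.1) (μ : HeckeCharacter L)
    (εH : ((cmDatum L 2 (Matrix.of fun i j : Fin 2 => if i.val + j.val + 1 = 2 then (1 : L) else 0)).Local v ×
      (cmDatum L 1 (Matrix.of fun i j : Fin 1 => if i.val + j.val + 1 = 1 then (1 : L) else 0)).Local v)) (a : LocalRing L v)
    (ha : (εH.1.val.val : Matrix (Fin 2) (Fin 2) (LocalRing L v)) = a • (1 : Matrix (Fin 2) (Fin 2) (LocalRing L v)))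
    (hu : (εH.2.val.val : Matrix (Fin 1) (Fin 1) (LocalRing L v)) 0 0 ≠ a)
    (P' : GL (Fin (2 + 1)) (LocalRing L v)) {ε' : (cmDatum L 3 H').Local v} (hmε' : IsLocalNormPair L H' v εH ε')
    (hε' : (ε'.val.val : Matrix (Fin 3) (Fin 3) (LocalRing L v)) * P'.val =
      P'.val * finSum 2 1 (a • (1 : Matrix (Fin 2) (Fin 2) (LocalRing L v))) (εH.2.val.val : Matrix (Fin 1) (Fin 1) (LocalRing L v))) :
    ∃ VΔ ∈ 𝓝 εH, ∀ γH ∈ VΔ, IsLocalGRegular L v γH → ∀ b : (cmDatum L 3 H').Local v,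
      (∃ x : (cmDatum L 3 H').Local v, ∃ B : Matrix (Fin 2) (Fin 2) (LocalRing L v), ((x * b * x⁻¹).val.val : Matrix (Fin 3) (Fin 3) (LocalRing L v)) * P'.val = P'.val * finSum 2 1 B (γH.2.val.val : Matrix (Fin 1) (Fin 1) (LocalRing L v))) →
        IsLocalNormPair L H' v γH b → finExplicitDelta L v H' γH μ b = finExplicitDelta L v H' εH μ ε' := by
  haveI hv : Subsingleton (PlacesOver L v) := PlacesOver.subsingleton_of_smul_eq (IsCMField.complexConj L) (IsCMField.complexConj_ne_one L) w hw
  have hu₀ : IsUnit ((finCharpolyTwo L v εH).eval (finGammaTwo L v εH)) := isUnit_eval_finCharpolyTwo_of_central L v w hw εH a ha hu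
  -- `τ`, `D` eventually constant at `ε_H`
  obtain ⟨VΔ, hVΔ, hV⟩ := ((finTau_eventually_eq L v μ hu₀).and (finWeylRatio_eventually_eq L v hu₀)).exists_mem
  -- the fixed vector `P′ e₃`
  set p' : Fin 3 → LocalRing L v := P'.val *ᵥ Pi.single (2 : Fin (2 + 1)) (1 : LocalRing L v) with hp'def
  have hne : p' ≠ 0 := mulVec_ne_zero_of_ne_zero₃ P' (by simp)
  -- `κ_v(ε_H, ε′)` read on `P′ e₃`
  have hpε' : (ε'.val.val : Matrix (Fin 3) (Fin 3) (LocalRing L v)) *ᵥ p' = finGammaTwo L v εH • p' := by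
    rw [hp'def, mulVec_mulVec, hε', ← mulVec_mulVec, finSum_two_one_mulVec_single_two', mulVec_smul]
    rfl
  have hκε' := finKappaAt_eq_ite_of_eigenvector L v H' εH ε' hv hmε' hu₀ hpε' hne
  refine ⟨VΔ, hVΔ, ?_⟩
  rintro γH hγ hreg b ⟨x, B, hxB⟩ hm
  obtain ⟨hτ, hD⟩ := hV γH hγ
  -- move to the conjugate `x b x⁻¹` in the frame
  have hmb : IsLocalNormPair L H' v γH (x * b * x⁻¹) :=
    (isLocalNormPair_conj_right (L := L) (v := v) (H' := H') (a := γH) (b := b) (y := x)).2 hm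
  have hΔ : finExplicitDelta L v H' γH μ b = finExplicitDelta L v H' γH μ (x * b * x⁻¹) := by
    rw [finExplicitDelta_conj_right_all L H' μ v γH b x]
  -- the common eigenvector `P′ e₃`, eigenvalue `u(γ_H)`
  have hp : ((x * b * x⁻¹).val.val : Matrix (Fin 3) (Fin 3) (LocalRing L v)) *ᵥ p' = finGammaTwo L v γH • p' := by
    rw [hp'def, mulVec_mulVec, hxB, ← mulVec_mulVec, finSum_two_one_mulVec_single_two', mulVec_smul]
    rfl
  have hκ := finKappaAt_eq_ite_of_eigenvector L v H' γH (x * b * x⁻¹) hv hmb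
    (isUnit_eval_finCharpolyTwo_of_isLocalGRegular (L := L) (v := v) (a := γH) hreg) hp hne
  rw [hΔ, finExplicitDelta_of_isLocalNormPair L v H' γH μ hmb, finExplicitDelta_of_isLocalNormPair L v H' εH μ hmε', hτ, hD, hκ, hκε']

/-! ## §3  Near `(ε_H, ε)` no matched element is on the `Q′`-side -/

/-- **NEAR `(ε_H, ε)` EVERY MATCHED ELEMENT IS ON THE DOCK SIDE.**  With the dock (`θ ε_H = ε`, frame `y·W`) and a bad frame `P′` as in the (R-inv) junction, there are
`N ∈ 𝓝 ε_H` and `U ∈ 𝓝 ε` such that for every `G`-regular `γ_H ∈ N` and every `γ′ ∈ U` matched with `γ_H`, NO conjugate of `γ′` is `P′·(B ⊕ᶠ u(γ_H))·P′⁻¹`.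
Proof: `Δ₀ := Δ‴_v(ε_H, ε) ≠ 0` (★ `finExplicitDelta_ne_zero_of_isUnit`); `Δ‴_v` is continuous on the matching locus at `(ε_H, ε)` (★ `continuousOn_finExplicitDelta`), so
`Δ‴_v(γ_H, γ′) ≠ −Δ₀` for matched `(γ_H, γ′)` near `(ε_H, ε)`; on the `Q′`-side `Δ‴_v(γ_H, γ′) = Δ‴_v(ε_H, ε′) = −Δ₀` (§2, §1).
[cite: Rogawski1990, §8.2 Prop. 8.2.1 (a)(d) pp. 118–122; §8.1 Prop. 8.1.3 p. 116; §4.9 p. 55] [cite: LanglandsShelstad1987, §1, Lemma 4.1.A] -/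
theorem exists_nhds_not_badFrame_of_isLocalNormPair (hH' : (H'.map (cmConjRingHom L))ᵀ = H') (hdet' : H'.det ≠ 0)
    (w : PlacesOver L v) (hw : IsCMField.complexConj L • w.1 = w.1) (μ : HeckeCharacter L)
    (εH : ((cmDatum L 2 (Matrix.of fun i j : Fin 2 => if i.val + j.val + 1 = 2 then (1 : L) else 0)).Local v ×
      (cmDatum L 1 (Matrix.of fun i j : Fin 1 => if i.val + j.val + 1 = 1 then (1 : L) else 0)).Local v)) (a : LocalRing L v)
    (ha : (εH.1.val.val : Matrix (Fin 2) (Fin 2) (LocalRing L v)) = a • (1 : Matrix (Fin 2) (Fin 2) (LocalRing L v)))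
    (hu : (εH.2.val.val : Matrix (Fin 1) (Fin 1) (LocalRing L v)) 0 0 ≠ a)
    (ε : (cmDatum L 3 H').Local v) (y : GL (Fin 3) (LocalRing L v))
    (θ : ((cmDatum L 2 (Matrix.of fun i j : Fin 2 => if i.val + j.val + 1 = 2 then (1 : L) else 0)).Local v ×
      (cmDatum L 1 (Matrix.of fun i j : Fin 1 => if i.val + j.val + 1 = 1 then (1 : L) else 0)).Local v) ≃ₜ* ↥(Subgroup.centralizer ({ε} : Set ((cmDatum L 3 H').Local v)))) (hθε : (θ εH).1 = ε)
    (hθ : ∀ z : ((cmDatum L 2 (Matrix.of fun i j : Fin 2 => if i.val + j.val + 1 = 2 then (1 : L) else 0)).Local v ×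
      (cmDatum L 1 (Matrix.of fun i j : Fin 1 => if i.val + j.val + 1 = 1 then (1 : L) else 0)).Local v), (((θ z).1).val : GL (Fin 3) (LocalRing L v)) = y * ((endoEmbLocal L v z).val : GL (Fin 3) (LocalRing L v)) * y⁻¹)
    {W : GL (Fin 3) (LocalRing L v)} (hW : W.val = !![(1 : LocalRing L v), 0, 0; 0, 0, 1; 0, 1, 0])
    {G₁ G₁' : Matrix (Fin 2) (Fin 2) (LocalRing L v)} {G₂ G₂' : Matrix (Fin 1) (Fin 1) (LocalRing L v)} {P' : GL (Fin (2 + 1)) (LocalRing L v)}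
    (hPW : twistGram (conjLocal L (IsCMField.complexConj L) v) ((adelicForm L 3 H').map (adeleToLocal L v)) (y * W).val = finSum 2 1 G₁ G₂)
    (hP' : twistGram (conjLocal L (IsCMField.complexConj L) v) ((adelicForm L 3 H').map (adeleToLocal L v)) P'.val = finSum 2 1 G₁' G₂')
    (hnn : ¬ ∃ z : LocalRing L v, IsUnit z ∧ G₁'.det = G₁.det * (conjLocal L (IsCMField.complexConj L) v z * z)) :
    ∃ N ∈ 𝓝 εH, ∃ U ∈ 𝓝 ε, ∀ γH ∈ N, IsLocalGRegular L v γH → ∀ γ' ∈ U, IsLocalNormPair L H' v γH γ' →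
      ¬ ∃ x : (cmDatum L 3 H').Local v, ∃ B : Matrix (Fin 2) (Fin 2) (LocalRing L v),
        ((x * γ' * x⁻¹).val.val : Matrix (Fin 3) (Fin 3) (LocalRing L v)) * P'.val = P'.val * finSum 2 1 B (γH.2.val.val : Matrix (Fin 1) (Fin 1) (LocalRing L v)) := by
  haveI hv : Subsingleton (PlacesOver L v) := PlacesOver.subsingleton_of_smul_eq (IsCMField.complexConj L) (IsCMField.complexConj_ne_one L) w hw
  have hu₀ : IsUnit ((finCharpolyTwo L v εH).eval (finGammaTwo L v εH)) := isUnit_eval_finCharpolyTwo_of_central L v w hw εH a ha hu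
  -- the second class `ε′` in the bad frame and its sign
  obtain ⟨ε', hε'⟩ := exists_secondClass_of_frame L H' v εH a ha hP'
  obtain ⟨hmε', hneg⟩ := finExplicitDelta_secondClass_eq_neg L H' v hH' hdet' w hw μ εH a ha hu ε y θ hθε hθ hW hPW hP' hnn hε'
  obtain ⟨VΔ, hVΔ, hbad⟩ := exists_nhds_finExplicitDelta_eq_secondClass_of_badFrame L H' v w hw μ εH a ha hu P' hmε' hε'
  -- `Δ₀ ≠ 0` and continuity of `Δ‴_v` at `(ε_H, ε)` on the matching locus
  have hyε : (ε.val : GL (Fin 3) (LocalRing L v)) = y * ((endoEmbLocal L v εH).val : GL (Fin 3) (LocalRing L v)) * y⁻¹ := by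
    rw [← hθε]; exact hθ εH
  have hmε : IsLocalNormPair L H' v εH ε := isLocalNormPair_of_val_eq_conj hyε
  have hΔ₀ : finExplicitDelta L v H' εH μ ε ≠ 0 := finExplicitDelta_ne_zero_of_isUnit L v H' εH ε μ hmε hu₀
  set S : Set (((cmDatum L 2 (Matrix.of fun i j : Fin 2 => if i.val + j.val + 1 = 2 then (1 : L) else 0)).Local v ×
      (cmDatum L 1 (Matrix.of fun i j : Fin 1 => if i.val + j.val + 1 = 1 then (1 : L) else 0)).Local v) × (cmDatum L 3 H').Local v) :=
    {q | IsLocalNormPair L H' v q.1 q.2 ∧ IsUnit ((finCharpolyTwo L v q.1).eval (finGammaTwo L v q.1))} with hSdef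
  have hcont := continuousOn_finExplicitDelta L v H' hH' hdet' μ
  have hmem : (εH, ε) ∈ S := ⟨hmε, hu₀⟩
  have hO : {z : ℂ | z ≠ -finExplicitDelta L v H' εH μ ε} ∈ 𝓝 (finExplicitDelta L v H' εH μ ε) := by
    refine isOpen_ne.mem_nhds ?_
    intro h
    exact hΔ₀ (by linear_combination h / 2)
  have hpre := (hcont (εH, ε) hmem).preimage_mem_nhdsWithin hO
  obtain ⟨T, hT, hTS⟩ := mem_nhdsWithin_iff_exists_mem_nhds_inter.1 hpre
  obtain ⟨N, hN, U, hU, hNU⟩ := mem_nhds_prod_iff.1 hT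
  refine ⟨N ∩ VΔ, inter_mem hN hVΔ, U, hU, ?_⟩
  rintro γH ⟨hγN, hγV⟩ hreg γ' hγ' hm hQ
  have hq1 : (γH, γ') ∈ T := hNU (Set.mk_mem_prod hγN hγ')
  have hq2 : (γH, γ') ∈ S := by
    rw [hSdef, Set.mem_setOf_eq]
    exact ⟨hm, isUnit_eval_finCharpolyTwo_of_isLocalGRegular (L := L) (v := v) (a := γH) hreg⟩
  have hq3 := hTS (Set.mem_inter hq1 hq2)
  rw [Set.mem_preimage, Set.mem_setOf_eq] at hq3
  -- `hq3 : Δ‴_v(γ_H, γ′) ≠ −Δ₀`; on the `Q′`-side it would equal `Δ‴_v(ε_H, ε′) = −Δ₀`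
  have hbadγ : finExplicitDelta L v H' γH μ γ' = finExplicitDelta L v H' εH μ ε' := hbad γH hγV hreg γ' hQ hm
  exact hq3 (hbadγ.trans hneg)

end DockSide

end Summit.HodgeConjecture.HodgeConjecture.Cruxes.H413.K2E3GermConstantRegularHRDockSideOnly

end
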